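import Mathlib
import Literature.MathematicalPhysics.QuantumFieldTheory.BalabanImbrieJaffe1984to88.BIJ85Eq7112SymbolFibreMin
import Literature.MathematicalPhysics.QuantumFieldTheory.BalabanImbrieJaffe1984to88.BIJ85Eq7113DerivationPart6
import Literature.MathematicalPhysics.QuantumFieldTheory.BalabanImbrieJaffe1984to88.BIJ85Thm711AllL

/-!
# `BalabanImbrieJaffe1984to88.BIJ85Eq7113SymbolIdentification` — T. Bałaban, J. Imbrie, A. Jaffe, *Renormalization of the Higgs
model: minimizers, propagators and the stability of mean field theory*, Commun. Math. Phys. **97** (1985) 299–329 [BalabanImbrieJaffe1985]: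
Sect. 7.1 p. 322 (7.1.12)–(7.1.13) — **`σ_k(p′) = τ₁(p′) + τ₂(p′)` FOR THE σ_k OF RECORD, AT EVERY GENERIC MOMENTUM**: the multiplication
operator `σ_k(p′)` of the torus σ_k of (4.2.1)–(4.2.2) (seats p09/p30 `sigmaTorus`, weight `η^d`, `η = L^{−k}`; its symbol = seat p33's
`symb sigmaMatrix p′`) satisfies **`⟨ψ, σ_k(p′)ψ⟩ = Re⟨ψ^asym, (τ₁ + τ₂)(p′)ψ^asym⟩`** with r15's (7.1.14)–(7.1.16) symbols VERBATIM
(`BIJ85Thm711Fibrewise.sigmaSym = tau1Sym + tau2Sym` at `η = L^{−k}`, cut-off `M = (L^k − 1)/2`) at every dual momentum `p′` of `T₁^{(k)}` with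
all components `p′_μ ≠ 0` — obtained by composing file 3's `⟨ψ, σ_k(p′)ψ⟩ = ½·m_{p′}(ψ^asym)` (the symbol IS the fibre minimum) with seat p10's
fibre algebra *"(7.1.12) ⟹ (7.1.13)"* `BIJ85Eq7113DerivationPart3.isLeast_energy` (the constrained minimum of the fibre exponent is the
(7.1.13) form) through seat p10's dictionaries `BIJ85Eq7113DerivationPart6.fibreEnergy_eq`/`fibreConstraint_iff` (p27's fibre energy =
2·the closed-cube energy, `n = 2M + 1`) and `BIJ85Eq7113DerivationPart5.energyC_eq_energy`/`qOpC_eq_qOp` (closed cube = generic fibre off the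
axes) — file 4 of 4 of the identification member; closes *"the (7.1.13) identification with Q^e_k(I − ∂G_{k,Ax}∂^*)Q^{e*}_k"* recorded
NOT CLAIMED in ROWS-C1 (rows C1.Thm7.1.1, C1.Eq7.1.13-7.1.19; p33's `BIJ85Tau1Config717` scope note) at the generic fibres

statement-level skeleton of published theorems with citation tags; proofs where landed; nothing here is a claim about
the Yang–Mills mass gap

PDF held: `paper:balaban1985-cmp97-bij-higgs-minimizers` (journal page = PDF page + 298).  Text read as images: PDF pp. 24–25 (journal
322–323; `run/shared/lean/pub/pub-balaban/t4/b2b-balaban-t4-lit2/renders/bij1985/1985-cmp97-bij-higgs-minimizers-p024-x2.png`, `…-p025-x2.png`).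

THE PRINTED TEXT (verbatim, p. 322).  *"The basic object we wish to study is σ_k, defined in (4.2.2), σ_k = Q^e_k(I − ∂G_{k,Ax}∂^*)Q^{e*}_k.
(7.1.12) The axial gauge Green's function G_{k,Ax} has a very complicated momentum space structure. Thus we use gauge invariance of
∂G_{k,Ax}∂^* to replace it by the Landau gauge operator ∂G_k∂^*. … Starting from this expression, one can derive the following formulas for
σ_k(p) by straightforward, algebraic manipulation: We express σ_k as a sum of two terms σ_k = τ₁ + τ₂. (7.1.13) Here τ₁ vanishes on curls.
Thus if f = ∂B, then τ₁f = 0. Explicitly τ_{1,μνλκ}(p′) = ½Σ_l(|u|²/(v̄_μv̄_νv_λv_κ)[δ_{μλ} − ∂_μ∂̄_λ/Δ][δ_{νκ} − ∂_ν∂̄_κ/Δ])(p′+l), (7.1.14)"*.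

CITATION HEADER (lean-in-tree rule).  Part of the lit-balaban TYPED SKELETON (HOME `run/shared/lean/pub/lit-balaban/`), Phase-2 seat p27
(gen 6), unit `lit-balaban-p27`; rows **C1.Eq7.1.13-7.1.19**, **C1.Eq7.1.2-7.1.12**, **C1.Thm7.1.1** of `HOME/SKELETON.md` (owner r15, referee
ref-5).  INPUTS (all landed, consumed by name): file 3 `BIJ85Eq7112SymbolFibreMin.symb_sigmaMatrix_form_eq_half_fibreMin`; seat p10's
`BIJ85Eq7113Derivation` (`energy`, `energySet`, `qOp`, `sigmaMin`), `…Part3` (`isLeast_energy`, `sigmaMin_eq`, `generic_scale`), `…Part5`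
(`energyC`, `qOpC`, `energyC_eq_energy`, `qOpC_eq_qOp`), `…Part6` (`resE`, `resR`, `fibreConstraint_iff`, `fibreEnergy_eq`); r15's symbols via
p10's `BIJ85Thm711Fibrewise.sigmaSym`.
WHAT IS KERNEL-CHECKED (zero `sorry`, standard axioms; theorems only — no `def`, no new named fact, D-0026): §1 the residue bookkeeping
(`resR ∘ resE = id` on `|m_i| ≤ M`, re-derived: p10's lemma is private) and `energyC_comp_res`/`qOpC_comp_res`; §2 **`fibreMin_eq_two_mul_sigmaForm`**
(`fibreMin (2M+1) N p′ φ = 2·Re⟨φ, (τ₁+τ₂)(p′)φ⟩` for two-forms `φ` at every `p′` with all `p′_μ ≠ 0`; `0 < d`) and `fibreMin_eq_two_mul_sigmaMin`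
(= `2·sigmaMin`, p10's fibre of (4.2.1)); §3 `fibreMin_congr_n`, `asymO_swap`, `eta_eq_inv_of_pow_eq`, and the assembled **`symb_sigmaMatrix_form_eq_sigmaSym`**:
for the σ_k of record (`k ≤ m + K`, `2 ≤ d`, any curl factor `c ≠ 0`, `L^k = 2M + 1` — `L` is odd in `Setup`), at every dual momentum `p′` of
`T₁^{(k)}` off the coordinate axes and every fibre vector `ψ`, `⟨ψ, σ_k(p′)ψ⟩ = Re⟨ψ^asym, sigmaSym (η_k) M (p′) ψ^asym⟩`; and (7.1.22) WITH
THE k-UNIFORM CONSTANT for the σ_k of record at EVERY `p′`: `fibreMin_ge_uniform` (+ `_allL`, p10 gen 5's every-`n` constant), **`symb_sigmaMatrix_coercive_uniform`** (`2·c711(d)·‖ψ‖² ≤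
Re⟨ψ, σ_k(p′)ψ⟩`, p33's `thm711_sigmaTorus` read fibrewise), `fibreMin_record_ge_uniform`.  HONEST SCOPE: the axis
fibres (some `p′_μ = 0`, where the printed symbols (7.1.10)/(7.1.14)–(7.1.16) are singular, GAPS G-C1-03) are covered by file 3's closed-form-free
identity `⟨ψ, σ_k(p′)ψ⟩ = ½·m_{p′}` only; even block sizes do not occur in `Setup`.
-/

namespace Literature.MathematicalPhysics.QuantumFieldTheory.BalabanImbrieJaffe1984to88.BIJ85Eq7113SymbolIdentification

open scoped BigOperators RealInnerProductSpace Matrix ComplexConjugate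
open Literature.MathematicalPhysics.QuantumFieldTheory.Balaban1983to89
open B5Prop11Plancherel (Tor fine sOf abs_sOf_le)
open B5Eq117TorusCarriers (Mk)
open BIJ85MomentumSymbols71 (tensorInner lShifts)
open BIJ85CurlComplement719 (IsTwoForm)
open BIJ85Thm711Fibrewise (Scale sigmaSym)
open BIJ85Eq7113Derivation (Generic energy energySet qOp sigmaMin pNormSq curlF)
open BIJ85Eq7113DerivationPart3 (isLeast_energy sigmaMin_eq generic_scale)
open BIJ85Eq7113DerivationPart5 (energyC qOpC qeStarC energyC_eq_energy qOpC_eq_qOp)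
open BIJ85Eq7113DerivationPart6 (resE resR fibreConstraint_iff fibreEnergy_eq hfib_twoForm)
open BIJ85SigmaClosedCube (c711 c711_pos)
open BIJ85Thm711AllLMultiplier (cAllL)
open BIJ85Thm711AllL (hfib_twoForm_allL)
open BIJ85Thm711Torus (thm711_sigmaTorus eta_pow_d_pos)
open BIJ85Eq7112FibreEnergy (fibreEnergy FibreConstraint)
open BIJ85Eq712Plancherel (symb)
open BIJ85Sigma712Torus (Orient torN sigmaMatrix fibrewise_of_inner_sigmaTorus_ge)
open BIJ85Thm711TorusTransport (asym asym_swap)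
open BIJ85Sigma421Torus BIJ85Eq7112FibreMin BIJ85Eq7112SymbolFibreMin

noncomputable section

variable {d : ℕ}

/-! ## §1 Residues: `resR ∘ resE = id` on `|m_i| ≤ M` (p10's private bookkeeping, re-derived) -/

section Residues

variable (M : ℕ)

/-- kernel: `a mod n = a + n` for `−n ≤ a < 0`. [folklore] -/
private theorem emod_eq_add_of_neg {a : ℤ} {n : ℕ} (h0 : a < 0) (h1 : -((n : ℕ) : ℤ) ≤ a) : a % (n : ℤ) = a + n := by
  calc a % (n : ℤ) = (a + n * 1) % n := (Int.add_mul_emod_self_left a n 1).symm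
    _ = a + n := by rw [mul_one]; exact Int.emod_eq_of_lt (by omega) (by omega)

/-- kernel: the residue of `m_i` as an integer. [folklore] -/
private theorem resE_val (m : Fin d → ℤ) (i : Fin d) : ((resE M m i : ℕ) : ℤ) = m i % (2 * M + 1 : ℕ) := by
  rw [resE, Fin.val_mk, Int.toNat_of_nonneg (Int.emod_nonneg _ (by omega))]

/-- kernel: `resR (resE m) = m` on the symmetric range `|m_i| ≤ M`. [folklore] -/
private theorem resR_resE {m : Fin d → ℤ} (hm : m ∈ lShifts d M) : resR M (resE M m) = m := by
  simp only [lShifts, Fintype.mem_piFinset, Finset.mem_Icc] at hm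
  funext i
  obtain ⟨h1, h2⟩ := hm i
  have hv : ((resE M m i : ℕ) : ℤ) = m i % ((2 * M + 1 : ℕ) : ℤ) := resE_val M m i
  unfold resR
  by_cases hnn : 0 ≤ m i
  · have he : m i % ((2 * M + 1 : ℕ) : ℤ) = m i := Int.emod_eq_of_lt hnn (by omega)
    rw [he] at hv
    have hle : (resE M m i : ℕ) ≤ M := by omega
    rw [if_pos hle]
    exact hv
  · have he : m i % ((2 * M + 1 : ℕ) : ℤ) = m i + ((2 * M + 1 : ℕ) : ℤ) := emod_eq_add_of_neg (by omega) (by omega)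
    rw [he] at hv
    have hgt : ¬ (resE M m i : ℕ) ≤ M := by omega
    rw [if_neg hgt]
    omega

/-- The closed-cube energy only sees the shifts `|m_i| ≤ M`: precomposing a field with `resR ∘ resE` does not change it.
[cite: BalabanImbrieJaffe1985, (7.1.10) p.322] -/
theorem energyC_comp_res (p : Fin d → ℝ) (A : (Fin d → ℤ) → Fin d → ℂ) (f : Fin d → Fin d → ℂ) :
    energyC (2 * M + 1) M p (fun m => A (resR M (resE M m))) f = energyC (2 * M + 1) M p A f := by
  unfold energyC pNormSq
  congr 1
  refine Finset.sum_congr rfl fun m hm => ?_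
  simp only [curlF, resR_resE M hm]

/-- … nor the closed-cube constraint map. [cite: BalabanImbrieJaffe1985, (7.1.10) p.322] -/
theorem qOpC_comp_res (p : Fin d → ℝ) (A : (Fin d → ℤ) → Fin d → ℂ) (ν : Fin d) :
    qOpC (2 * M + 1) M p (fun m => A (resR M (resE M m))) ν = qOpC (2 * M + 1) M p A ν := by
  unfold qOpC
  refine Finset.sum_congr rfl fun m hm => ?_
  simp only [resR_resE M hm]

end Residues

/-! ## §2 The fibre minimum in closed form at generic momenta: `m_{p′}(φ) = 2·Re⟨φ, (τ₁ + τ₂)(p′)φ⟩` -/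

section Generic

variable (M : ℕ) {N : Fin d → ℕ} [∀ μ, NeZero (N μ)]

/-- **THE FIBRE MINIMUM IS THE (7.1.13) FORM**: for odd block size `n = 2M + 1`, every dual momentum `p′` with all `p′_μ ≠ 0` and every
two-form `φ`, `fibreMin (2M+1) N p′ φ = 2·Re⟨φ, σ_k(p′)φ⟩_{(7.1.3)}` with `σ_k(p′) = sigmaSym (1/n) M (p′) = τ₁(p′) + τ₂(p′)` — r15's symbols
(7.1.14)–(7.1.16) verbatim (the `2` = ordered-pair convention of the `Tor` two-forms vs the plaquette pairing (2.20)).  Seat p10's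
`isLeast_energy` through the dictionaries of its Parts 5–6. [cite: BalabanImbrieJaffe1985, (7.1.13) p.322] -/
theorem fibreMin_eq_two_mul_sigmaForm (hd : 0 < d) (q : Tor N) (hq : ∀ i, sOf N q i ≠ 0) {φ : Fin d × Fin d → ℂ}
    (hφ : ∀ μ ν, φ (ν, μ) = -φ (μ, ν)) :
    fibreMin (2 * M + 1) N q φ
      = 2 * (tensorInner (fun μ ν => φ (μ, ν)) (sigmaSym (((2 * M + 1 : ℕ) : ℝ)⁻¹) M (sOf N q)) (fun μ ν => φ (μ, ν))).re := by
  have hn : 0 < 2 * M + 1 := by omega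
  have hp : ∀ i, sOf N q i ≠ 0 ∧ |sOf N q i| ≤ Real.pi := fun i => ⟨hq i, abs_sOf_le N q i⟩
  have hf : IsTwoForm (fun μ ν => φ (μ, ν)) := fun μ ν => hφ μ ν
  have hG : Generic (((2 * M + 1 : ℕ) : ℝ)⁻¹) M (sOf N q) := generic_scale hd ⟨2 * M + 1, M, le_rfl⟩ hp
  have hL := isLeast_energy hG hf
  apply le_antisymm
  · -- `≤`: transport p10's minimiser to a constrained fibre family
    obtain ⟨⟨A₀, hA₀, hE⟩, -⟩ := hL
    set α : (Fin d → Fin (2 * M + 1)) → Fin d → ℂ := fun k => A₀ (resR M k) with hα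
    have hcomp : (fun m => α (resE M m)) = fun m => A₀ (resR M (resE M m)) := rfl
    have hαc : FibreConstraint (2 * M + 1) N q α := by
      rw [fibreConstraint_iff M q α, hcomp]
      intro ν
      rw [qOpC_comp_res, qOpC_eq_qOp hn hp]
      exact hA₀ ν
    calc fibreMin (2 * M + 1) N q φ ≤ fibreEnergy (2 * M + 1) N q α φ := fibreMin_le _ _ hαc φ
      _ = 2 * energyC (2 * M + 1) M (sOf N q) (fun m => α (resE M m)) (fun μ ν => φ (μ, ν)) := fibreEnergy_eq M q α hφ
      _ = _ := by rw [hcomp, energyC_comp_res, energyC_eq_energy hn hp A₀ hf, hE]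
  · -- `≥`: every constrained fibre family gives a constrained field of p10's problem
    refine (le_fibreMin_iff _ _).2 fun α hα => ?_
    rw [fibreEnergy_eq M q α hφ, energyC_eq_energy hn hp _ hf]
    have hmem : energy (((2 * M + 1 : ℕ) : ℝ)⁻¹) M (sOf N q) (fun m => α (resE M m)) (fun μ ν => φ (μ, ν))
        ∈ energySet (((2 * M + 1 : ℕ) : ℝ)⁻¹) M (sOf N q) (fun μ ν => φ (μ, ν)) := by
      refine ⟨_, fun ν => ?_, rfl⟩
      rw [← qOpC_eq_qOp hn hp]
      exact (fibreConstraint_iff M q α).1 hα ν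
    have h2 := hL.2 hmem
    linarith

/-- … equivalently `fibreMin (2M+1) N p′ φ = 2·sigmaMin (1/n) M p′ φ` — p10's fibre of (4.2.1)/(7.1.12) (`BIJ85Eq7113Derivation.sigmaMin`,
*"inf{‖∂A − Q^{e*}_kf‖² : Q_kA = 0}"* in the `lShifts` presentation). [cite: BalabanImbrieJaffe1985, (7.1.12) p.322] -/
theorem fibreMin_eq_two_mul_sigmaMin (hd : 0 < d) (q : Tor N) (hq : ∀ i, sOf N q i ≠ 0) {φ : Fin d × Fin d → ℂ}
    (hφ : ∀ μ ν, φ (ν, μ) = -φ (μ, ν)) :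
    fibreMin (2 * M + 1) N q φ = 2 * sigmaMin (((2 * M + 1 : ℕ) : ℝ)⁻¹) M (sOf N q) (fun μ ν => φ (μ, ν)) := by
  have hp : ∀ i, sOf N q i ≠ 0 ∧ |sOf N q i| ≤ Real.pi := fun i => ⟨hq i, abs_sOf_le N q i⟩
  have hf : IsTwoForm (fun μ ν => φ (μ, ν)) := fun μ ν => hφ μ ν
  have hG : Generic (((2 * M + 1 : ℕ) : ℝ)⁻¹) M (sOf N q) := generic_scale hd ⟨2 * M + 1, M, le_rfl⟩ hp
  rw [fibreMin_eq_two_mul_sigmaForm M hd q hq hφ, (sigmaMin_eq hG hf).1]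

/-- **The fibre minimum is bounded below UNIFORMLY**: `2·c711(d)·Σ_a|φ_a|² ≤ fibreMin (2M+1) N p′ φ` for every two-form `φ` at EVERY dual
momentum `p′` (axis fibres and `p′ = 0` included) — p10's `hfib_twoForm` ((7.1.21)–(7.1.22) on the closed cube) through `le_fibreMin_iff`.
[cite: BalabanImbrieJaffe1985, (7.1.22) p.324] -/
theorem fibreMin_ge_uniform (hd : 0 < d) (q : Tor N) {φ : Fin d × Fin d → ℂ} (hφ : ∀ μ ν, φ (ν, μ) = -φ (μ, ν)) :
    2 * c711 d * ∑ a, ‖φ a‖ ^ 2 ≤ fibreMin (2 * M + 1) N q φ :=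
  (le_fibreMin_iff _ _).2 fun α hα => hfib_twoForm M hd q hφ α hα

/-- … and for EVERY block size `n` with seat p10 gen 5's all-`n` constant: `cAllL(d)·Σ_a|φ_a|² ≤ fibreMin n N p′ φ` (p10's
`BIJ85Thm711AllL.hfib_twoForm_allL`, weak duality over the complete residue system). [cite: BalabanImbrieJaffe1985, (7.1.22) p.324] -/
theorem fibreMin_ge_uniform_allL (n : ℕ) [NeZero n] (hd : 0 < d) (q : Tor N) {φ : Fin d × Fin d → ℂ}
    (hφ : ∀ μ ν, φ (ν, μ) = -φ (μ, ν)) : cAllL d * ∑ a, ‖φ a‖ ^ 2 ≤ fibreMin n N q φ :=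
  (le_fibreMin_iff _ _).2 fun α hα => hfib_twoForm_allL n N hd q hφ α hα

end Generic

/-! ## §3 The σ_k of record: `⟨ψ, σ_k(p′)ψ⟩ = Re⟨ψ^asym, (τ₁ + τ₂)(p′)ψ^asym⟩` at every generic dual momentum -/

section Record

variable {P : Params} {k : ℕ}

/-- Re-indexing the block size along an equation (the `Fin n` offsets depend on `n`). [cite: BalabanImbrieJaffe1985, (7.1.12) p.322] -/
theorem fibreMin_congr_n {n n' : ℕ} [NeZero n] [NeZero n'] (h : n = n') (N : Fin d → ℕ) [∀ μ, NeZero (N μ)] (q : Tor N)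
    (φ : Fin d × Fin d → ℂ) : fibreMin n N q φ = fibreMin n' N q φ := by
  subst h
  rfl

/-- `asymO ψ` is a two-form. [cite: BalabanImbrieJaffe1985, (7.1.3) p.321] -/
theorem asymO_swap (ψ : Orient P → ℂ) (μ ν : Fin P.d) : asymO ψ (ν, μ) = -asymO ψ (μ, ν) := by
  have h := asym_swap (fun b : Unit × Orient P => ψ b.2) () μ ν
  rw [asym_apply_eq_asymO, asym_apply_eq_asymO] at h
  exact h

/-- `η_k = L^{−k} = 1/(2M+1)` when `L^k = 2M + 1`. [cite: Balaban1987RG1, (1.1) p.260] -/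
theorem eta_eq_inv_of_pow_eq {M : ℕ} (hM : P.L ^ k = 2 * M + 1) : P.eta k = (((2 * M + 1 : ℕ) : ℝ))⁻¹ := by
  rw [Params.eta, inv_pow, ← hM, Nat.cast_pow]

/-- **`σ_k(p′) = τ₁(p′) + τ₂(p′)` FOR THE σ_k OF RECORD** (p. 322 *"one can derive the following formulas for σ_k(p) … σ_k = τ₁ + τ₂ (7.1.13)"*):
for the torus σ_k of (4.2.1)–(4.2.2) in the physical normalisation (weight `η^d`, `η = L^{−k}`, any curl factor `c ≠ 0`; `k ≤ m + K`, `2 ≤ d`;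
`L^k = 2M + 1`), at EVERY dual momentum `p′` of `T₁^{(k)}` with all `p′_μ ≠ 0` and for every fibre vector `ψ` on the orientations:
`⟨ψ, σ_k(p′)ψ⟩ = Re⟨ψ^asym, sigmaSym η M (p′) ψ^asym⟩_{(7.1.3)}` — p33's multiplication operator `symb sigmaMatrix p′` on the left, r15's
`tau1Sym + tau2Sym` ((7.1.14)–(7.1.16) verbatim) on the right. [cite: BalabanImbrieJaffe1985, (7.1.13) p.322] -/
theorem symb_sigmaMatrix_form_eq_sigmaSym (hd : 2 ≤ P.d) (hk : k ≤ P.m + P.K) {c : ℝ} (hc : c ≠ 0) {M : ℕ} (hM : P.L ^ k = 2 * M + 1)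
    (p : Tor (torN P k)) (hp : ∀ i, sOf (Mk P k) p i ≠ 0) (ψ : Orient P → ℂ) :
    star ψ ⬝ᵥ (symb (torN P k) (Orient P) (sigmaMatrix hd (P.eta k ^ P.d) c k) p *ᵥ ψ)
      = (((tensorInner (fun μ ν => asymO ψ (μ, ν)) (sigmaSym (P.eta k) M (sOf (Mk P k) p)) (fun μ ν => asymO ψ (μ, ν))).re : ℝ) : ℂ) := by
  haveI : NeZero (2 * M + 1) := ⟨by omega⟩
  rw [symb_sigmaMatrix_form_eq_half_fibreMin hd hk hc p ψ, fibreMin_congr_n hM,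
    fibreMin_eq_two_mul_sigmaForm M (by omega : 0 < P.d) p hp (asymO_swap ψ), eta_eq_inv_of_pow_eq hM]
  push_cast
  ring

/-- The same with p10's fibre minimum `sigmaMin` of (4.2.1)/(7.1.12): `⟨ψ, σ_k(p′)ψ⟩ = sigmaMin η M p′ ψ^asym`.
[cite: BalabanImbrieJaffe1985, (7.1.12) p.322] -/
theorem symb_sigmaMatrix_form_eq_sigmaMin (hd : 2 ≤ P.d) (hk : k ≤ P.m + P.K) {c : ℝ} (hc : c ≠ 0) {M : ℕ} (hM : P.L ^ k = 2 * M + 1)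
    (p : Tor (torN P k)) (hp : ∀ i, sOf (Mk P k) p i ≠ 0) (ψ : Orient P → ℂ) :
    star ψ ⬝ᵥ (symb (torN P k) (Orient P) (sigmaMatrix hd (P.eta k ^ P.d) c k) p *ᵥ ψ)
      = ((sigmaMin (P.eta k) M (sOf (Mk P k) p) (fun μ ν => asymO ψ (μ, ν)) : ℝ) : ℂ) := by
  haveI : NeZero (2 * M + 1) := ⟨by omega⟩
  rw [symb_sigmaMatrix_form_eq_half_fibreMin hd hk hc p ψ, fibreMin_congr_n hM,
    fibreMin_eq_two_mul_sigmaMin M (by omega : 0 < P.d) p hp (asymO_swap ψ), eta_eq_inv_of_pow_eq hM]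
  push_cast
  ring

/-- kernel: `Σ_a|ψ^asym_a|² = 2·Σ_o|ψ_o|²` (each orientation counted twice). [folklore] -/
private theorem sum_norm_sq_asymO (ψ : Orient P → ℂ) : ∑ a, ‖asymO ψ a‖ ^ 2 = 2 * ∑ o, ‖ψ o‖ ^ 2 := by
  have h := BIJ85Thm711TorusTransport.sum_norm_sq_asym (fun b : Unit × Orient P => ψ b.2)
  rw [Fintype.sum_prod_type, Fintype.sum_prod_type, Finset.univ_unique, Finset.sum_singleton, Finset.sum_singleton] at h
  simpa [asym_apply_eq_asymO] using h

/-- **(7.1.22) FOR THE σ_k OF RECORD WITH THE k-UNIFORM CONSTANT** (*"It is sufficient to show that there is a constant c > 0 such that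
c ≤ σ_k(p) (7.1.22) for all |p_j| ≤ π"*): `2·c711(d)·‖ψ‖² ≤ Re⟨ψ, σ_k(p′)ψ⟩` at EVERY dual momentum `p′` of `T₁^{(k)}` (axis fibres included),
for every `k ≤ m + K`, every curl factor `c ≠ 0` — p33's configuration-space Theorem 7.1.1 `thm711_sigmaTorus` read fibrewise
(`fibrewise_of_inner_sigmaTorus_ge`); the constant depends on `d` only (p33 g3's `symb_sigmaMatrix_coercive` had a k-dependent one).
[cite: BalabanImbrieJaffe1985, Prop. 7.1.2 (7.1.22) p.324] -/
theorem symb_sigmaMatrix_coercive_uniform (hd : 2 ≤ P.d) (hk : k ≤ P.m + P.K) {c : ℝ} (hc : c ≠ 0)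
    (p : Tor (torN P k)) (ψ : Orient P → ℂ) :
    2 * c711 P.d * ∑ o, ‖ψ o‖ ^ 2 ≤ (star ψ ⬝ᵥ (symb (torN P k) (Orient P) (sigmaMatrix hd (P.eta k ^ P.d) c k) p *ᵥ ψ)).re :=
  fibrewise_of_inner_sigmaTorus_ge hd hk (eta_pow_d_pos P k) hc (fun g => thm711_sigmaTorus hd hk hc g) p ψ

/-- The same bound read on the fibre minimum of the σ_k of record: `4·c711(d)·‖ψ‖² ≤ fibreMin (L^k) (Mk P k) p′ ψ^asym` at every `p′`
(file 3's identity `⟨ψ, σ_k(p′)ψ⟩ = ½·fibreMin`; consistent with `fibreMin_ge_uniform`). [cite: BalabanImbrieJaffe1985, (7.1.22) p.324] -/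
theorem fibreMin_record_ge_uniform (hd : 2 ≤ P.d) (hk : k ≤ P.m + P.K) (p : Tor (torN P k)) (ψ : Orient P → ℂ) :
    4 * c711 P.d * ∑ o, ‖ψ o‖ ^ 2 ≤ fibreMin (P.L ^ k) (Mk P k) p (asymO ψ) := by
  have h := symb_sigmaMatrix_coercive_uniform hd hk (one_ne_zero) p ψ
  rw [symb_sigmaMatrix_form_eq_half_fibreMin hd hk one_ne_zero p ψ, Complex.ofReal_re] at h
  linarith

/-- `L^k` is odd (every `Setup` has `L` odd), so the cut-off `M = (L^k − 1)/2` of the two theorems above exists for every `k`.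
[cite: BalabanImbrieJaffe1985, (7.1.10) p.322] -/
theorem exists_pow_eq_two_mul_add_one (P : Params) (k : ℕ) : ∃ M : ℕ, P.L ^ k = 2 * M + 1 :=
  P.hL.1.pow

end Record

end

end Literature.MathematicalPhysics.QuantumFieldTheory.BalabanImbrieJaffe1984to88.BIJ85Eq7113SymbolIdentification
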